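import Literature.NumberTheory.Congruences.BernoulliCharacterTeichmullerCongruence
import Summits.BirchSwinnertonDyer.BirchSwinnertonDyer.Theorems.PrintCFramBottomClassIndexLawFiveLeBernoulliUnitsFourLifts
import Summits.BirchSwinnertonDyer.BirchSwinnertonDyer.Theorems.PrintCFramBottomClassIndexLawFiveLeKrizLiBindersCharacters
import Summits.BirchSwinnertonDyer.Rank1Residual.X12.O11.RouteUBernoulliCertificate
import Literature.NumberTheory.Automorphic.EichlerEmbeddingLocalLevel
import HarnessLib

/-!
# Crux `PrintCFram.BottomClassIndexLawFiveLe` (stmt-BirchSwinnertonDyer-20372), line `eisenstein-resource-bdp-line` (registry v18):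
# THE KUMMER DICTIONARY — the line's two Bernoulli numbers `B_{1,ψ⁻¹}` (CLASS factor, B1) and `B_{1,ψε_Kω⁻¹}` (FIELD factor,
# B2′ / kriz-li-cover Stub C) ARE `B_{p−k,χ⁻¹}/(p−k)` and `B_{k,χε_K}/k` modulo `p`
# (cell `bsd-print-cfram`, width seat `bsd-line-cfram-p1-w8` g3; THEOREMS ONLY, `--supports` 20372; BSD is not proved by any of this)

HONEST FRAMING. Nothing here is a statement about BSD; no stub of the skeleton is closed and the registry is unchanged. What is
proved is a DICTIONARY for the premises of the two research stubs of registry v18 — B1 `stub_bsdp_of_classFactor` (premise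
`‖bernoulliOnePrim ψ⁻¹‖ ≤ p⁻¹`) and B2′ `stub_bsdp_of_noAdmissibleHeegnerField` (premise `‖bernoulliOnePrim (bernoulliCharTwo ψ εK ω)‖ ≤ p⁻¹`
for every admissible Heegner field), equivalently of Stub C of the unregistered line `kriz-li-cover` — in the currency of the
generalized Bernoulli numbers `B_{k,χ}/k = −L(1−k, χ)` of the member's quadratic character `χ` (for the field factor: of `χ·ε_K`),
i.e. Cohen–Eisenstein numbers `H(k, |D|)` up to sign. This is the currency in which (i) bsd-idea-7 g12's census engine for Stub C
computes (`B_{m,χ_G} mod p`, `Lines/kriz-li-cover.md`), (ii) the presearch verdicts on B2′ are phrased (Wiles 2015 / Beckwith 2017 at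
`n = 1`, Byeon 2003 at `n = 2`; `Lines/eisenstein-resource-bdp-line-w3g7-B2prime-presearch.md`), and (iii) LEAD g10's report ADDENDUM 2
reads the `K''`-factor («`B_{1,χ_{D'}ω^{(p−3)/4}} ≡ unit·B_{n,χ_{D'}}/n`», used there informally). The engine is the Literature
theorem `CharacterTwist.norm_generalizedBernoulli_one_sub_div_lt_one` (the χ-twisted Kummer congruence
`B_{1,χω^{j}} ≡ B_{j+1,χ}/(j+1) (mod p)`, `1 ≤ j ≤ p − 3`, `p ∤ cond χ`; landed by this seat, p671219).

* §0 `‖x‖ < 1 ⟺ ‖x‖ ≤ p⁻¹` in `ℚ_p` (the stubs write `≤ p⁻¹`, the congruences write `< 1`; tree lemma `Brandt.norm_lt_one_iff_le_inv`).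
* §1 The character `Θ = χ↑·(ω^j)↑` at level `m·p` (`m ⊥ p`, `χ` primitive mod `m`, `0 < j < p − 1`): PRIMITIVE (`thetaShape_isPrimitive`)
  with values `Θ(b) = χ(b)ω(b)^j` at every `b ∈ ℕ` (`thetaShape_apply_natCast`).
* §2 VALUES FORM. For ANY character `Ψ` (any level) agreeing with `χ(ℓ)ω(ℓ)^j` at all primes `ℓ` off a finite set:
  `bernoulliOnePrim Ψ = B_{1,Θ}` (`bernoulliOnePrim_eq_generalizedBernoulli_thetaShape`; the primitive character inducing `Ψ` is `Θ`,
  via w3 g7's `BernoulliUnits.changeLevel_eq_of_forall_prime_apply_eq`), hence **`‖bernoulliOnePrim Ψ − B_{j+1,χ}/(j+1)‖ < 1`**,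
  `‖bernoulliOnePrim Ψ‖ ≤ 1`, and `‖bernoulliOnePrim Ψ‖ < 1 ⟺ ‖B_{j+1,χ}/(j+1)‖ < 1` (also with `≤ p⁻¹`), `1 ≤ j ≤ p − 3`.
* §3 CLASS FACTOR for the class character `ψ = χ↑·(ω^k)↑` of `KrizLiBinders` (level `p·m`, `2 ≤ k ≤ p − 2`):
  `ψ⁻¹(ℓ) = χ⁻¹(ℓ)ω(ℓ)^{p−1−k}`, so **`‖B_{1,ψ⁻¹~}‖ ≤ p⁻¹ ⟺ ‖B_{p−k,χ⁻¹}/(p−k)‖ ≤ p⁻¹`** (`norm_bernoulliOnePrim_psi_inv_le_inv_iff`).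
  On the crux's classes (`KrizLiBinders.exists_krizLiData_of_base`: `χ = χ_e` quadratic, `k ∈ {(p+1)/4, (3p−1)/4}` making `ψ` odd)
  this reads: `W` is Eisenstein-IRREGULAR at `p` (a B1 member) iff `p ∣ B_{p−k,χ_e}/(p−k)`; for the anchors `A(p)` (`χ = 1`):
  iff `p ∣ B_{p−k}/(p−k)`, an ordinary Bernoulli number (`k = (p+1)/4` for `p ≡ 3 (mod 8)`).
* §4 FIELD FACTOR: for `ψ` odd and `ε_K` mod `d`, at primes `ℓ ∤ p·m·d`, `(ψ₀ω⁻¹)(ℓ) = χ(ℓ)ε_K(ℓ)ω(ℓ)^{k−1}`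
  (`bernoulliCharTwo_psi_apply_natCast_of_coprime`); so for any PRIMITIVE `χε` of level prime to `p` agreeing with `χ·ε_K` at almost all primes
  (the primitive quadratic character of `e·d_K` in the application) **`‖B_{1,(ψε_Kω⁻¹)~}‖ ≤ p⁻¹ ⟺ ‖B_{k,χε}/k‖ ≤ p⁻¹`**
  (`norm_bernoulliOnePrim_bernoulliCharTwo_le_inv_iff`), and the instance `χε := (χ↑·ε_K↑).primitiveCharacter` (`…_primitiveCharacter`).
  With `k = (p+1)/4 =: n`: B2′'s premise at `K''` is `p ∣ B_{n,χ_{e d_K}}/n = −L(1−n, χ_{e d_K})`.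

What this does NOT do: it proves neither B1 nor B2′ (both are `BSD_p` statements); it changes no stub; the class-wide reading on
the crux's binders (any odd `(f, ψ, ω)` with `hss`) goes through the pair-uniqueness transfer of w3 g3/w3 g7
(`OffLocusDictionary.bernoulliPair_eq_of_hss`) and is not restated here. beyond-print theorem: NO (Kummer 1851 / Washington Ch. 5
bookkeeping, new to the tree for `χ ≠ 1`).

References: [LangCyclotomic1990] Ch. 2 §2 Thm. 2.5; [Washington1997] Thm. 5.11, Cor. 5.13, §5.1; [KrizLi2019] §1.5 (1), §2, Thm. 1.20;
[Cohen1975] (`H(r, N)`); LEAD g10 report `Lines/eisenstein-resource-bdp-line-lead-g10.md` ADDENDUM 2; `Lines/kriz-li-cover.md`.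
-/

set_option autoImplicit false
-- summit-side namespace `Summit.BirchSwinnertonDyer.BirchSwinnertonDyer.…` (single-conjunct summit, D-0017 layout)
set_option linter.dupNamespace false

noncomputable section

open scoped Classical
open DirichletCharacter Literature.NumberTheory.LFunctions Literature.NumberTheory.EllipticCurves.KrizLi2019
open Literature.NumberTheory.Congruences

namespace Summit.BirchSwinnertonDyer.BirchSwinnertonDyer.Theorems.PrintCFram.KummerDictionary

open Summit.BirchSwinnertonDyer.BirchSwinnertonDyer.Theorems.PrintCFram
open Summit.BirchSwinnertonDyer.Rank1Residual.X12.O11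

variable {p : ℕ} [hp : Fact p.Prime]

/-! ## §0 `‖x‖ < 1 ⟺ ‖x‖ ≤ p⁻¹` is the tree's `Literature.NumberTheory.Automorphic.Brandt.norm_lt_one_iff_le_inv`
(the stubs write `≤ p⁻¹`, the congruence files write `< 1`). -/

open Literature.NumberTheory.Automorphic.Brandt (norm_lt_one_iff_le_inv)

/-! ## §1 The character `Θ = χ↑·(ω^j)↑` at level `m·p` -/

section Theta

variable {m : ℕ} [hm : NeZero m]

/-- **`Θ = χ↑·(ω^j)↑` (level `m·p`) is PRIMITIVE** for `χ` primitive mod `m`, `m ⊥ p`, `ω` Teichmüller and `0 < j < p − 1`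
(`ω^j ≠ 1` has conductor `p`; coprime conductors multiply — cell `bsd-cm`'s `RouteU.conductor_changeLevel_mul_changeLevel`).
[cite: Washington1997, Ch. 3 (conductors) and §5.1 (ω has order p − 1)] -/
theorem thetaShape_isPrimitive (hmp : m.Coprime p) (χ : DirichletCharacter ℚ_[p] m) (hχ : χ.IsPrimitive)
    {ω : DirichletCharacter ℚ_[p] p} (hω : IsTeichmullerCharacter ω) {j : ℕ} (hj0 : 0 < j) (hj : j < p - 1) :
    (changeLevel (dvd_mul_right m p) χ * changeLevel (dvd_mul_left p m) (ω ^ j) :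
      DirichletCharacter ℚ_[p] (m * p)).IsPrimitive := by
  have hωj : ω ^ j ≠ 1 := KrizLiBinders.teichmuller_pow_ne_one hω hj0 hj
  have hcq : χ.conductor = m := hχ
  have hcp : (ω ^ j).conductor = p := RouteU.conductor_eq_of_prime_of_ne_one (ω ^ j) hωj
  rw [isPrimitive_def, RouteU.conductor_changeLevel_mul_changeLevel _ _ χ (ω ^ j) (by rw [hcq, hcp]; exact hmp), hcq, hcp]

omit hm in
/-- **Values of `Θ` at every natural number**: `Θ(b) = χ(b)·ω(b)^j` (`j ≠ 0`; both sides vanish off the units).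
[cite: Washington1997, Ch. 3 (p. 19, characters as functions on ℤ)] -/
theorem thetaShape_apply_natCast (χ : DirichletCharacter ℚ_[p] m) (ω : DirichletCharacter ℚ_[p] p) {j : ℕ} (hj0 : j ≠ 0)
    (b : ℕ) :
    (changeLevel (dvd_mul_right m p) χ * changeLevel (dvd_mul_left p m) (ω ^ j) :
      DirichletCharacter ℚ_[p] (m * p)) (b : ZMod (m * p)) = χ (b : ZMod m) * ω (b : ZMod p) ^ j := by
  rw [CharacterTwist.changeLevel_mul_changeLevel_apply_natCast, MulChar.pow_apply' _ hj0]

/-! ## §2 The values form of the dictionary -/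

/-- **The primitive character inducing `Ψ` is `Θ`.** If `Ψ` (any level `n`) agrees with `χ(ℓ)ω(ℓ)^j` at every prime `ℓ` off a
finite set (`ℓ ∤ N₀`), then `bernoulliOnePrim Ψ = B_{1,Θ}` with `Θ = χ↑·(ω^j)↑` primitive of level `m·p`: the two characters have the
same lift to level `n·(m·p)` (Dirichlet: every unit class contains a prime `ℓ ∤ N₀`, w3 g7's
`BernoulliUnits.changeLevel_eq_of_forall_prime_apply_eq`), `bernoulliOnePrim` only sees the lift, and for a primitive character it is
`generalizedBernoulli 1` itself. [cite: KrizLi2019, §2 (p. 11, primitive characters) and §1.5 (1) (p. 7)] -/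
theorem bernoulliOnePrim_eq_generalizedBernoulli_thetaShape (hmp : m.Coprime p) (χ : DirichletCharacter ℚ_[p] m)
    (hχ : χ.IsPrimitive) {ω : DirichletCharacter ℚ_[p] p} (hω : IsTeichmullerCharacter ω) {j : ℕ} (hj0 : 0 < j)
    (hj : j < p - 1) {n : ℕ} [NeZero n] (Ψ : DirichletCharacter ℚ_[p] n) {N₀ : ℕ} (hN₀ : N₀ ≠ 0)
    (hΨ : ∀ ℓ : ℕ, ℓ.Prime → ¬ ℓ ∣ N₀ → Ψ (ℓ : ZMod n) = χ (ℓ : ZMod m) * ω (ℓ : ZMod p) ^ j) :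
    bernoulliOnePrim Ψ =
      generalizedBernoulli 1 (changeLevel (dvd_mul_right m p) χ * changeLevel (dvd_mul_left p m) (ω ^ j)) := by
  set Θ : DirichletCharacter ℚ_[p] (m * p) :=
    changeLevel (dvd_mul_right m p) χ * changeLevel (dvd_mul_left p m) (ω ^ j) with hΘ
  have e : changeLevel (dvd_mul_right n (m * p)) Ψ = changeLevel (dvd_mul_left (m * p) n) Θ := by
    refine BernoulliUnits.changeLevel_eq_of_forall_prime_apply_eq _ _ Ψ Θ (N := N₀) hN₀ fun ℓ hℓ hℓN _ ↦ ?_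
    rw [hΨ ℓ hℓ hℓN, hΘ, thetaShape_apply_natCast χ ω hj0.ne' ℓ]
  rw [BernoulliUnits.bernoulliOnePrim_eq_of_changeLevel_eq _ _ Ψ Θ e,
    RouteU.bernoulliOnePrim_eq_of_isPrimitive Θ (thetaShape_isPrimitive hmp χ hχ hω hj0 hj)]

/-- **THE DICTIONARY, values form: `B_{1,Ψ~} ≡ B_{j+1,χ}/(j+1) (mod p)`.** For `m ⊥ p`, `χ` primitive mod `m` (`ℚ_p`-valued),
`ω` Teichmüller, `1 ≤ j ≤ p − 3`, and ANY Dirichlet character `Ψ` with `Ψ(ℓ) = χ(ℓ)ω(ℓ)^j` at all primes `ℓ ∤ N₀`: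
`‖bernoulliOnePrim Ψ − B_{j+1,χ}/(j+1)‖_p < 1` — the χ-twisted Kummer congruence (`CharacterTwist.norm_generalizedBernoulli_one_sub_div_lt_one`)
read on the primitive character inducing `Ψ`. [cite: Washington1997, Thm. 5.11 and Cor. 5.13] [cite: LangCyclotomic1990, Ch. 2 §2, Thm. 2.5] -/
theorem norm_bernoulliOnePrim_sub_div_lt_one_of_values (hmp : m.Coprime p) (χ : DirichletCharacter ℚ_[p] m)
    (hχ : χ.IsPrimitive) {ω : DirichletCharacter ℚ_[p] p} (hω : IsTeichmullerCharacter ω) {j : ℕ} (h1j : 1 ≤ j)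
    (hjp : j ≤ p - 3) {n : ℕ} [NeZero n] (Ψ : DirichletCharacter ℚ_[p] n) {N₀ : ℕ} (hN₀ : N₀ ≠ 0)
    (hΨ : ∀ ℓ : ℕ, ℓ.Prime → ¬ ℓ ∣ N₀ → Ψ (ℓ : ZMod n) = χ (ℓ : ZMod m) * ω (ℓ : ZMod p) ^ j) :
    ‖bernoulliOnePrim Ψ - ((j + 1 : ℕ) : ℚ_[p])⁻¹ * generalizedBernoulli (j + 1) χ‖ < 1 := by
  rw [bernoulliOnePrim_eq_generalizedBernoulli_thetaShape hmp χ hχ hω (by omega) (by omega) Ψ hN₀ hΨ]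
  have h := CharacterTwist.norm_generalizedBernoulli_one_sub_div_lt_one hmp χ ω hω (k := j + 1) (by omega) (by omega)
  simpa only [Nat.add_sub_cancel] using h

/-- **Integrality: `‖bernoulliOnePrim Ψ‖ ≤ 1`** under the same hypotheses. [cite: Washington1997, Thm. 5.11 and Cor. 5.13] -/
theorem norm_bernoulliOnePrim_le_one_of_values (hmp : m.Coprime p) (χ : DirichletCharacter ℚ_[p] m)
    (hχ : χ.IsPrimitive) {ω : DirichletCharacter ℚ_[p] p} (hω : IsTeichmullerCharacter ω) {j : ℕ} (h1j : 1 ≤ j)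
    (hjp : j ≤ p - 3) {n : ℕ} [NeZero n] (Ψ : DirichletCharacter ℚ_[p] n) {N₀ : ℕ} (hN₀ : N₀ ≠ 0)
    (hΨ : ∀ ℓ : ℕ, ℓ.Prime → ¬ ℓ ∣ N₀ → Ψ (ℓ : ZMod n) = χ (ℓ : ZMod m) * ω (ℓ : ZMod p) ^ j) :
    ‖bernoulliOnePrim Ψ‖ ≤ 1 := by
  rw [bernoulliOnePrim_eq_generalizedBernoulli_thetaShape hmp χ hχ hω (by omega) (by omega) Ψ hN₀ hΨ]
  have h := CharacterTwist.norm_generalizedBernoulli_one_le_one hmp χ ω hω (k := j + 1) (by omega) (by omega)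
  simpa only [Nat.add_sub_cancel] using h

/-- **`p ∣ B_{1,Ψ~} ⟺ p ∣ B_{j+1,χ}/(j+1)`** (both as `‖·‖ < 1`). [cite: Washington1997, Thm. 5.11 and Cor. 5.13] [cite: LangCyclotomic1990, Ch. 2 §2, Thm. 2.5] -/
theorem norm_bernoulliOnePrim_lt_one_iff_of_values (hmp : m.Coprime p) (χ : DirichletCharacter ℚ_[p] m)
    (hχ : χ.IsPrimitive) {ω : DirichletCharacter ℚ_[p] p} (hω : IsTeichmullerCharacter ω) {j : ℕ} (h1j : 1 ≤ j)
    (hjp : j ≤ p - 3) {n : ℕ} [NeZero n] (Ψ : DirichletCharacter ℚ_[p] n) {N₀ : ℕ} (hN₀ : N₀ ≠ 0)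
    (hΨ : ∀ ℓ : ℕ, ℓ.Prime → ¬ ℓ ∣ N₀ → Ψ (ℓ : ZMod n) = χ (ℓ : ZMod m) * ω (ℓ : ZMod p) ^ j) :
    ‖bernoulliOnePrim Ψ‖ < 1 ↔ ‖((j + 1 : ℕ) : ℚ_[p])⁻¹ * generalizedBernoulli (j + 1) χ‖ < 1 := by
  rw [bernoulliOnePrim_eq_generalizedBernoulli_thetaShape hmp χ hχ hω (by omega) (by omega) Ψ hN₀ hΨ]
  have h := CharacterTwist.norm_generalizedBernoulli_one_lt_one_iff hmp χ ω hω (k := j + 1) (by omega) (by omega)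
  simpa only [Nat.add_sub_cancel] using h

/-- **The same in the stubs' currency `‖·‖ ≤ p⁻¹`.** [cite: Washington1997, Thm. 5.11 and Cor. 5.13] -/
theorem norm_bernoulliOnePrim_le_inv_iff_of_values (hmp : m.Coprime p) (χ : DirichletCharacter ℚ_[p] m)
    (hχ : χ.IsPrimitive) {ω : DirichletCharacter ℚ_[p] p} (hω : IsTeichmullerCharacter ω) {j : ℕ} (h1j : 1 ≤ j)
    (hjp : j ≤ p - 3) {n : ℕ} [NeZero n] (Ψ : DirichletCharacter ℚ_[p] n) {N₀ : ℕ} (hN₀ : N₀ ≠ 0)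
    (hΨ : ∀ ℓ : ℕ, ℓ.Prime → ¬ ℓ ∣ N₀ → Ψ (ℓ : ZMod n) = χ (ℓ : ZMod m) * ω (ℓ : ZMod p) ^ j) :
    ‖bernoulliOnePrim Ψ‖ ≤ (p : ℝ)⁻¹ ↔
      ‖((j + 1 : ℕ) : ℚ_[p])⁻¹ * generalizedBernoulli (j + 1) χ‖ ≤ (p : ℝ)⁻¹ := by
  rw [← norm_lt_one_iff_le_inv, ← norm_lt_one_iff_le_inv]
  exact norm_bernoulliOnePrim_lt_one_iff_of_values hmp χ hχ hω h1j hjp Ψ hN₀ hΨ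

end Theta

/-! ## §3 The CLASS factor `B_{1,ψ⁻¹}` of the class character `ψ = χ↑·(ω^k)↑` -/

section ClassFactor

variable {m : ℕ} [hm : NeZero m] (ω : DirichletCharacter ℚ_[p] p) (χ : DirichletCharacter ℚ_[p] m) (k : ℕ)

/-- `ω(ℓ) ≠ 0` at `p ∤ ℓ` for a Teichmüller character (its value is a root of unity). [cite: Washington1997, §5.1] -/
theorem teichmuller_apply_ne_zero {ℓ : ℕ} (hℓ : ¬ p ∣ ℓ) : ω (ℓ : ZMod p) ≠ 0 := by
  have h := norm_apply_eq_one ω (ℓ : ℤ) (by exact_mod_cast hℓ)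
  rw [Int.cast_natCast] at h
  intro h0
  rw [h0, norm_zero] at h
  exact zero_ne_one h

omit hm in
/-- **`ψ⁻¹(ℓ) = χ⁻¹(ℓ)·ω(ℓ)^{p−1−k}`** at every prime (indeed every) `ℓ ∤ p·m`, for `ψ = χ↑·(ω^k)↑`, `0 < k ≤ p − 1`
(`ω(ℓ)^{p−1} = 1`). [cite: KrizLi2019, §2 (p. 11)] [cite: Washington1997, §5.1 (ω(a)^{p−1} = 1)] -/
theorem psi_inv_apply_natCast_of_coprime (hk0 : k ≠ 0) (hkp : k ≤ p - 1) {ℓ : ℕ} (hℓ : ℓ.Coprime (p * m)) :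
    (changeLevel (dvd_mul_left m p) χ * changeLevel (dvd_mul_right p m) (ω ^ k) :
      DirichletCharacter ℚ_[p] (p * m))⁻¹ (ℓ : ZMod (p * m)) = χ⁻¹ (ℓ : ZMod m) * ω (ℓ : ZMod p) ^ (p - 1 - k) := by
  have hℓp0 : ℓ.Coprime p := Nat.Coprime.coprime_mul_right_right hℓ
  have hℓp : ¬ p ∣ ℓ := fun h ↦ hp.out.ne_one (Nat.Coprime.eq_one_of_dvd (Nat.coprime_comm.mp hℓp0) h)
  rw [MulChar.inv_apply_eq_inv', KrizLiBinders.psi_apply_natCast_of_coprime ω χ k hk0 hℓ, mul_inv,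
    ← MulChar.inv_apply_eq_inv']
  congr 1
  have hω1 : ω (ℓ : ZMod p) ^ (p - 1) = 1 := by
    have h := apply_pow_sub_one_eq_one ω (ℓ : ℤ) (by exact_mod_cast hℓp)
    rwa [Int.cast_natCast] at h
  refine inv_eq_of_mul_eq_one_right ?_
  rw [← pow_add, show k + (p - 1 - k) = p - 1 by omega, hω1]

/-- **CLASS FACTOR: `‖B_{1,ψ⁻¹~} − B_{p−k,χ⁻¹}/(p−k)‖_p < 1`** for the class character `ψ = χ↑·(ω^k)↑` (`m ⊥ p`, `χ` primitive
mod `m`, `ω` Teichmüller, `2 ≤ k ≤ p − 2`). [cite: Washington1997, Thm. 5.11 and Cor. 5.13] [cite: KrizLi2019, Thm. 1.20 (p. 8, the Bernoulli hypothesis)] -/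
theorem norm_bernoulliOnePrim_psi_inv_sub_div_lt_one (hmp : m.Coprime p) (hχ : χ.IsPrimitive)
    (hω : IsTeichmullerCharacter ω) (h2k : 2 ≤ k) (hkp : k ≤ p - 2) :
    ‖bernoulliOnePrim (changeLevel (dvd_mul_left m p) χ * changeLevel (dvd_mul_right p m) (ω ^ k) :
        DirichletCharacter ℚ_[p] (p * m))⁻¹ -
      ((p - k : ℕ) : ℚ_[p])⁻¹ * generalizedBernoulli (p - k) χ⁻¹‖ < 1 := by
  haveI : NeZero (p * m) := ⟨Nat.mul_ne_zero hp.out.ne_zero hm.out⟩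
  have hχ' : χ⁻¹.IsPrimitive := by rw [isPrimitive_def, conductor_inv]; exact hχ
  have h := norm_bernoulliOnePrim_sub_div_lt_one_of_values hmp χ⁻¹ hχ' hω (j := p - 1 - k) (by omega) (by omega)
    (Ψ := (changeLevel (dvd_mul_left m p) χ * changeLevel (dvd_mul_right p m) (ω ^ k) :
      DirichletCharacter ℚ_[p] (p * m))⁻¹) (N₀ := p * m) (Nat.mul_ne_zero hp.out.ne_zero hm.out)
    (fun ℓ hℓ hℓN ↦ psi_inv_apply_natCast_of_coprime ω χ k (by omega) (by omega)
      ((Nat.Prime.coprime_iff_not_dvd hℓ).mpr hℓN))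
  have e : p - 1 - k + 1 = p - k := by omega
  rw [e] at h
  exact h

/-- **CLASS FACTOR, divisibility form: `p ∣ B_{1,ψ⁻¹~} ⟺ p ∣ B_{p−k,χ⁻¹}/(p−k)`** (as `‖·‖ < 1`).
[cite: Washington1997, Thm. 5.11 and Cor. 5.13] [cite: KrizLi2019, Thm. 1.20 (p. 8)] -/
theorem norm_bernoulliOnePrim_psi_inv_lt_one_iff (hmp : m.Coprime p) (hχ : χ.IsPrimitive)
    (hω : IsTeichmullerCharacter ω) (h2k : 2 ≤ k) (hkp : k ≤ p - 2) :
    ‖bernoulliOnePrim (changeLevel (dvd_mul_left m p) χ * changeLevel (dvd_mul_right p m) (ω ^ k) :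
        DirichletCharacter ℚ_[p] (p * m))⁻¹‖ < 1 ↔
      ‖((p - k : ℕ) : ℚ_[p])⁻¹ * generalizedBernoulli (p - k) χ⁻¹‖ < 1 := by
  haveI : NeZero (p * m) := ⟨Nat.mul_ne_zero hp.out.ne_zero hm.out⟩
  have hχ' : χ⁻¹.IsPrimitive := by rw [isPrimitive_def, conductor_inv]; exact hχ
  have h := norm_bernoulliOnePrim_lt_one_iff_of_values hmp χ⁻¹ hχ' hω (j := p - 1 - k) (by omega) (by omega)
    (Ψ := (changeLevel (dvd_mul_left m p) χ * changeLevel (dvd_mul_right p m) (ω ^ k) :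
      DirichletCharacter ℚ_[p] (p * m))⁻¹) (N₀ := p * m) (Nat.mul_ne_zero hp.out.ne_zero hm.out)
    (fun ℓ hℓ hℓN ↦ psi_inv_apply_natCast_of_coprime ω χ k (by omega) (by omega)
      ((Nat.Prime.coprime_iff_not_dvd hℓ).mpr hℓN))
  have e : p - 1 - k + 1 = p - k := by omega
  rw [e] at h
  exact h

/-- **CLASS FACTOR in the stubs' currency: `‖B_{1,ψ⁻¹~}‖ ≤ p⁻¹ ⟺ ‖B_{p−k,χ⁻¹}/(p−k)‖ ≤ p⁻¹`** — B1's premise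
`‖bernoulliOnePrim ψ⁻¹‖ ≤ p⁻¹` for the class character. [cite: KrizLi2019, Thm. 1.20 (p. 8)] [cite: Washington1997, Thm. 5.11 and Cor. 5.13] -/
theorem norm_bernoulliOnePrim_psi_inv_le_inv_iff (hmp : m.Coprime p) (hχ : χ.IsPrimitive)
    (hω : IsTeichmullerCharacter ω) (h2k : 2 ≤ k) (hkp : k ≤ p - 2) :
    ‖bernoulliOnePrim (changeLevel (dvd_mul_left m p) χ * changeLevel (dvd_mul_right p m) (ω ^ k) :
        DirichletCharacter ℚ_[p] (p * m))⁻¹‖ ≤ (p : ℝ)⁻¹ ↔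
      ‖((p - k : ℕ) : ℚ_[p])⁻¹ * generalizedBernoulli (p - k) χ⁻¹‖ ≤ (p : ℝ)⁻¹ := by
  rw [← norm_lt_one_iff_le_inv, ← norm_lt_one_iff_le_inv]
  exact norm_bernoulliOnePrim_psi_inv_lt_one_iff ω χ k hmp hχ hω h2k hkp

end ClassFactor

/-! ## §4 The FIELD factor `B_{1,ψε_Kω⁻¹}` -/

section FieldFactor

variable {m : ℕ} [hm : NeZero m] (ω : DirichletCharacter ℚ_[p] p) (χ : DirichletCharacter ℚ_[p] m) (k : ℕ)
  {d : ℕ} [hd : NeZero d] (εK : DirichletCharacter ℚ_[p] d)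

/-- **`(ψ₀ω⁻¹)(ℓ) = χ(ℓ)·ε_K(ℓ)·ω(ℓ)^{k−1}`** at every `ℓ` prime to `p·m·d`, for the ODD class character `ψ = χ↑·(ω^k)↑` (`k ≠ 0`):
Kriz–Li's second character `bernoulliCharTwo ψ εK ω = (ψ·ε_K)↑·(ω⁻¹)↑` (w2 g4 `RegularLocusBernoulliPair.bernoulliCharTwo_of_not_even`)
evaluated at a unit. [cite: KrizLi2019, §1.5 (p. 7, ψ₀ = ψε_K for ψ odd) and Thm. 1.20 (p. 8)] -/
theorem bernoulliCharTwo_psi_apply_natCast_of_coprime (hk0 : k ≠ 0)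
    (hodd : ¬ (changeLevel (dvd_mul_left m p) χ * changeLevel (dvd_mul_right p m) (ω ^ k) :
      DirichletCharacter ℚ_[p] (p * m)).Even) {ℓ : ℕ} (hℓ : ℓ.Coprime (p * m * d * p)) :
    bernoulliCharTwo (changeLevel (dvd_mul_left m p) χ * changeLevel (dvd_mul_right p m) (ω ^ k) :
        DirichletCharacter ℚ_[p] (p * m)) εK ω (ℓ : ZMod (p * m * d * p)) =
      χ (ℓ : ZMod m) * εK (ℓ : ZMod d) * ω (ℓ : ZMod p) ^ (k - 1) := by
  haveI : NeZero (p * m) := ⟨Nat.mul_ne_zero hp.out.ne_zero hm.out⟩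
  have hℓpmd : ℓ.Coprime (p * m * d) := Nat.Coprime.coprime_mul_right_right hℓ
  have hℓpm : ℓ.Coprime (p * m) := Nat.Coprime.coprime_mul_right_right hℓpmd
  have hℓp : ℓ.Coprime p := Nat.Coprime.coprime_mul_right_right hℓpm
  have hℓd : ℓ.Coprime d := Nat.Coprime.coprime_mul_left_right hℓpmd
  have hℓp' : ¬ p ∣ ℓ := fun h ↦ hp.out.ne_one (Nat.Coprime.eq_one_of_dvd (Nat.coprime_comm.mp hℓp) h)
  rw [RegularLocusBernoulliPair.bernoulliCharTwo_of_not_even _ εK ω hodd, MulChar.mul_apply,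
    EisensteinPair.changeLevel_apply_natCast _ _ hℓ, EisensteinPair.changeLevel_apply_natCast _ _ hℓ, MulChar.mul_apply,
    EisensteinPair.changeLevel_apply_natCast _ _ hℓpmd, EisensteinPair.changeLevel_apply_natCast _ _ hℓpmd,
    KrizLiBinders.psi_apply_natCast_of_coprime ω χ k hk0 hℓpm, MulChar.inv_apply_eq_inv']
  have hω0 : ω (ℓ : ZMod p) ≠ 0 := teichmuller_apply_ne_zero ω hℓp'
  have e : ω (ℓ : ZMod p) ^ k = ω (ℓ : ZMod p) ^ (k - 1) * ω (ℓ : ZMod p) := by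
    rw [← pow_succ, Nat.sub_add_cancel (Nat.pos_of_ne_zero hk0)]
  have hinv : ω (ℓ : ZMod p) * (ω (ℓ : ZMod p))⁻¹ = 1 := mul_inv_cancel₀ hω0
  rw [e]
  linear_combination (χ (ℓ : ZMod m) * εK (ℓ : ZMod d) * ω (ℓ : ZMod p) ^ (k - 1)) * hinv

/-- **FIELD FACTOR: `‖B_{1,(ψε_Kω⁻¹)~} − B_{k,χε}/k‖_p < 1`** for the odd class character `ψ = χ↑·(ω^k)↑` (`m ⊥ p`,
`2 ≤ k ≤ p − 2`), `ε_K` mod `d`, and ANY primitive `χε` of level `c ⊥ p` agreeing with `χ·ε_K` at all primes off a finite set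
(in the application: the primitive quadratic character of `e·d_K`). [cite: Washington1997, Thm. 5.11 and Cor. 5.13] [cite: KrizLi2019, Thm. 1.20 (p. 8, the Bernoulli hypothesis)] -/
theorem norm_bernoulliOnePrim_bernoulliCharTwo_sub_div_lt_one (hω : IsTeichmullerCharacter ω)
    (h2k : 2 ≤ k) (hkp : k ≤ p - 2)
    (hodd : ¬ (changeLevel (dvd_mul_left m p) χ * changeLevel (dvd_mul_right p m) (ω ^ k) :
      DirichletCharacter ℚ_[p] (p * m)).Even)
    {c : ℕ} [NeZero c] (hcp : c.Coprime p) (χε : DirichletCharacter ℚ_[p] c) (hχε : χε.IsPrimitive) {N₁ : ℕ} (hN₁ : N₁ ≠ 0)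
    (hval : ∀ ℓ : ℕ, ℓ.Prime → ¬ ℓ ∣ N₁ → χε (ℓ : ZMod c) = χ (ℓ : ZMod m) * εK (ℓ : ZMod d)) :
    ‖bernoulliOnePrim (bernoulliCharTwo (changeLevel (dvd_mul_left m p) χ * changeLevel (dvd_mul_right p m) (ω ^ k) :
        DirichletCharacter ℚ_[p] (p * m)) εK ω) - (k : ℚ_[p])⁻¹ * generalizedBernoulli k χε‖ < 1 := by
  haveI : NeZero (p * m) := ⟨Nat.mul_ne_zero hp.out.ne_zero hm.out⟩
  have hN₀ : N₁ * (p * m * d * p) ≠ 0 :=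
    Nat.mul_ne_zero hN₁ (Nat.mul_ne_zero (Nat.mul_ne_zero (Nat.mul_ne_zero hp.out.ne_zero hm.out) hd.out) hp.out.ne_zero)
  have h := norm_bernoulliOnePrim_sub_div_lt_one_of_values hcp χε hχε hω (j := k - 1) (by omega) (by omega)
    (Ψ := bernoulliCharTwo (changeLevel (dvd_mul_left m p) χ * changeLevel (dvd_mul_right p m) (ω ^ k) :
      DirichletCharacter ℚ_[p] (p * m)) εK ω) (N₀ := N₁ * (p * m * d * p)) hN₀ (fun ℓ hℓ hℓN ↦ by
        have hℓN₁ : ¬ ℓ ∣ N₁ := fun h' ↦ hℓN (h'.mul_right _)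
        have hℓL : ¬ ℓ ∣ p * m * d * p := fun h' ↦ hℓN (h'.mul_left _)
        rw [bernoulliCharTwo_psi_apply_natCast_of_coprime ω χ k εK (by omega) hodd
          ((Nat.Prime.coprime_iff_not_dvd hℓ).mpr hℓL), hval ℓ hℓ hℓN₁])
  have e : k - 1 + 1 = k := by omega
  rw [e] at h
  exact h

/-- **FIELD FACTOR, divisibility form: `p ∣ B_{1,(ψε_Kω⁻¹)~} ⟺ p ∣ B_{k,χε}/k`** (as `‖·‖ < 1`).
[cite: Washington1997, Thm. 5.11 and Cor. 5.13] [cite: KrizLi2019, Thm. 1.20 (p. 8)] -/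
theorem norm_bernoulliOnePrim_bernoulliCharTwo_lt_one_iff (hω : IsTeichmullerCharacter ω)
    (h2k : 2 ≤ k) (hkp : k ≤ p - 2)
    (hodd : ¬ (changeLevel (dvd_mul_left m p) χ * changeLevel (dvd_mul_right p m) (ω ^ k) :
      DirichletCharacter ℚ_[p] (p * m)).Even)
    {c : ℕ} [NeZero c] (hcp : c.Coprime p) (χε : DirichletCharacter ℚ_[p] c) (hχε : χε.IsPrimitive) {N₁ : ℕ} (hN₁ : N₁ ≠ 0)
    (hval : ∀ ℓ : ℕ, ℓ.Prime → ¬ ℓ ∣ N₁ → χε (ℓ : ZMod c) = χ (ℓ : ZMod m) * εK (ℓ : ZMod d)) :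
    ‖bernoulliOnePrim (bernoulliCharTwo (changeLevel (dvd_mul_left m p) χ * changeLevel (dvd_mul_right p m) (ω ^ k) :
        DirichletCharacter ℚ_[p] (p * m)) εK ω)‖ < 1 ↔ ‖(k : ℚ_[p])⁻¹ * generalizedBernoulli k χε‖ < 1 := by
  haveI : NeZero (p * m) := ⟨Nat.mul_ne_zero hp.out.ne_zero hm.out⟩
  have hN₀ : N₁ * (p * m * d * p) ≠ 0 :=
    Nat.mul_ne_zero hN₁ (Nat.mul_ne_zero (Nat.mul_ne_zero (Nat.mul_ne_zero hp.out.ne_zero hm.out) hd.out) hp.out.ne_zero)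
  have h := norm_bernoulliOnePrim_lt_one_iff_of_values hcp χε hχε hω (j := k - 1) (by omega) (by omega)
    (Ψ := bernoulliCharTwo (changeLevel (dvd_mul_left m p) χ * changeLevel (dvd_mul_right p m) (ω ^ k) :
      DirichletCharacter ℚ_[p] (p * m)) εK ω) (N₀ := N₁ * (p * m * d * p)) hN₀ (fun ℓ hℓ hℓN ↦ by
        have hℓN₁ : ¬ ℓ ∣ N₁ := fun h' ↦ hℓN (h'.mul_right _)
        have hℓL : ¬ ℓ ∣ p * m * d * p := fun h' ↦ hℓN (h'.mul_left _)
        rw [bernoulliCharTwo_psi_apply_natCast_of_coprime ω χ k εK (by omega) hodd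
          ((Nat.Prime.coprime_iff_not_dvd hℓ).mpr hℓL), hval ℓ hℓ hℓN₁])
  have e : k - 1 + 1 = k := by omega
  rw [e] at h
  exact h

/-- **FIELD FACTOR in the stubs' currency: `‖B_{1,(ψε_Kω⁻¹)~}‖ ≤ p⁻¹ ⟺ ‖B_{k,χε}/k‖ ≤ p⁻¹`** — B2′'s premise at one Heegner
field, for the class character. [cite: KrizLi2019, Thm. 1.20 (p. 8)] [cite: Washington1997, Thm. 5.11 and Cor. 5.13] -/
theorem norm_bernoulliOnePrim_bernoulliCharTwo_le_inv_iff (hω : IsTeichmullerCharacter ω)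
    (h2k : 2 ≤ k) (hkp : k ≤ p - 2)
    (hodd : ¬ (changeLevel (dvd_mul_left m p) χ * changeLevel (dvd_mul_right p m) (ω ^ k) :
      DirichletCharacter ℚ_[p] (p * m)).Even)
    {c : ℕ} [NeZero c] (hcp : c.Coprime p) (χε : DirichletCharacter ℚ_[p] c) (hχε : χε.IsPrimitive) {N₁ : ℕ} (hN₁ : N₁ ≠ 0)
    (hval : ∀ ℓ : ℕ, ℓ.Prime → ¬ ℓ ∣ N₁ → χε (ℓ : ZMod c) = χ (ℓ : ZMod m) * εK (ℓ : ZMod d)) :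
    ‖bernoulliOnePrim (bernoulliCharTwo (changeLevel (dvd_mul_left m p) χ * changeLevel (dvd_mul_right p m) (ω ^ k) :
        DirichletCharacter ℚ_[p] (p * m)) εK ω)‖ ≤ (p : ℝ)⁻¹ ↔
      ‖(k : ℚ_[p])⁻¹ * generalizedBernoulli k χε‖ ≤ (p : ℝ)⁻¹ := by
  rw [← norm_lt_one_iff_le_inv, ← norm_lt_one_iff_le_inv]
  exact norm_bernoulliOnePrim_bernoulliCharTwo_lt_one_iff ω χ k εK hω h2k hkp hodd hcp χε hχε hN₁ hval

/-- **The canonical instance `χε := (χ↑·ε_K↑)~`**, the primitive character inducing `χ·ε_K` (level `m·d`, `d ⊥ p`): its level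
(= conductor) is prime to `p` and it agrees with `χ(ℓ)ε_K(ℓ)` at every prime `ℓ ∤ m·d`; hence
`‖B_{1,(ψε_Kω⁻¹)~}‖ < 1 ⟺ ‖B_{k,(χε_K)~}/k‖ < 1`. [cite: KrizLi2019, §2 (p. 11, the primitive character `ψ₁ψ₂`) and Thm. 1.20 (p. 8)] [cite: Washington1997, Thm. 5.11 and Cor. 5.13] -/
theorem norm_bernoulliOnePrim_bernoulliCharTwo_lt_one_iff_primitiveCharacter (hmp : m.Coprime p)
    (hω : IsTeichmullerCharacter ω) (h2k : 2 ≤ k) (hkp : k ≤ p - 2)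
    (hodd : ¬ (changeLevel (dvd_mul_left m p) χ * changeLevel (dvd_mul_right p m) (ω ^ k) :
      DirichletCharacter ℚ_[p] (p * m)).Even) (hdp : d.Coprime p) :
    ‖bernoulliOnePrim (bernoulliCharTwo (changeLevel (dvd_mul_left m p) χ * changeLevel (dvd_mul_right p m) (ω ^ k) :
        DirichletCharacter ℚ_[p] (p * m)) εK ω)‖ < 1 ↔
      ‖(k : ℚ_[p])⁻¹ * @generalizedBernoulli ℚ_[p] _ _
          (changeLevel (dvd_mul_right m d) χ * changeLevel (dvd_mul_left d m) εK).conductor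
          ⟨conductor_ne_zero _⟩ k
          (changeLevel (dvd_mul_right m d) χ * changeLevel (dvd_mul_left d m) εK).primitiveCharacter‖ < 1 := by
  set Φ : DirichletCharacter ℚ_[p] (m * d) := changeLevel (dvd_mul_right m d) χ * changeLevel (dvd_mul_left d m) εK with hΦ
  haveI : NeZero Φ.conductor := ⟨conductor_ne_zero _⟩
  have hc : Φ.conductor.Coprime p := Nat.Coprime.coprime_dvd_left (conductor_dvd_level Φ) (Nat.Coprime.mul_left hmp hdp)
  refine norm_bernoulliOnePrim_bernoulliCharTwo_lt_one_iff ω χ k εK hω h2k hkp hodd hc Φ.primitiveCharacter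
    (primitiveCharacter_isPrimitive Φ) (N₁ := m * d) (Nat.mul_ne_zero hm.out hd.out) fun ℓ hℓ hℓN ↦ ?_
  have hcop : IsCoprime (ℓ : ℤ) ((m * d : ℕ) : ℤ) :=
    Nat.isCoprime_iff_coprime.mpr ((Nat.Prime.coprime_iff_not_dvd hℓ).mpr hℓN)
  have h := primitiveCharacter_apply_of_isCoprime Φ hcop
  rw [Int.cast_natCast, Int.cast_natCast] at h
  rw [h, hΦ, CharacterTwist.changeLevel_mul_changeLevel_apply_natCast]

end FieldFactor

end Summit.BirchSwinnertonDyer.BirchSwinnertonDyer.Theorems.PrintCFram.KummerDictionary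

end
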